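import Mathlib
import HarnessLib
import HarnessLib.Audit
import Summits.FinalStateConjecture.Statement
import HarnessLib.Audit.Status.Attr

/-!
Route: TameStrataCurveSelection

# Route TameStrataCurveSelection — tame exceptional traces along analytic local probes plus cone
selection give Christodoulou's curve, conjunction-free

It suffices to show X = TAME EXCEPTIONAL TRACES (decl `TameExceptionalTraces`): through every
admissible datum d failing
the summit property P (MGHD exists ∧ every MGHD has complete 𝓘⁺ and settles to finitely many
sub-extremal Kerrs with
exhaustive charts) passes a jointly smooth, injective, admissible 2-parameter family F : ℝ² → 𝓓, F 0
= d, whose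
exceptional trace {c : ¬P(F c)} is, near c = 0, contained in {0} ∪ finitely many ARCS from 0
(continuous γ : [0,1] → ℝ²,
γ(0) = 0, differentiable at 0 with γ'(0) ≠ 0, γ(t) ≠ 0 for t > 0) — the ℝ²-shadow of "the
exceptional set is a tame
(o-minimal) set of empty interior along the probe". X is reached by the three cruxes of card
tame-strata-curve-selection:
tameness of the SETTLING-exceptional trace and of the CENSORSHIP-exceptional trace along EVERY
compactly supported analytic
admissible 2-probe (dichotomy FAT ∨ THIN), and LOCAL ANALYTIC UNFOLDING (through every exceptional
datum some such probe
along which good parameters are dense near 0). X → Statement is the provable-now support lemma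
ConeSelection (a line
through 0 in ℝ² missing finitely many tangent directions meets the arcs only at 0 near 0;
reparametrise by arctan).
Lean: `∀ (X : Type) [TopologicalSpace X] [ChartedSpace (EuclideanSpace ℝ (Fin 3)) X] [IsManifold (𝓡
3) ((⊤ : ℕ∞) : WithTop ℕ∞) X] [T2Space X] [SecondCountableTopology X] [ConnectedSpace X], ∀ d ∈
Literature.Geometry.Lorentzian.admissibleVacuumData X, ¬ ((∃ 𝒟 :
Literature.Geometry.Lorentzian.VacuumCauchyDevelopment d, 𝒟.IsMaximal) ∧ ∀ 𝒟 :
Literature.Geometry.Lorentzian.VacuumCauchyDevelopment d, 𝒟.IsMaximal →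
Summit.FinalStateConjecture.HasCompleteNullInfinity 𝒟.toCauchyDevelopment ∧ ∃ (O : Set 𝒟.carrier) (e
: Literature.Geometry.Lorentzian.FinalStateDecomposition 𝒟.toSpacetime O 2), (∀ i,
Literature.Geometry.Lorentzian.Kerr.IsSubextremal (e.mass i) (e.spin i)) ∧ O =
Summit.FinalStateConjecture.exteriorOf 𝒟.toCauchyDevelopment e.charted ∧
Summit.FinalStateConjecture.HasExhaustiveCharts e) → ∃ F : EuclideanSpace ℝ (Fin 2) →
Literature.Geometry.Lorentzian.InitialDataSet (𝓡 3) X,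
Literature.Geometry.Lorentzian.InitialDataSet.IsSmoothDataFamily 2 F ∧ F 0 = d ∧ Function.Injective
F ∧ (∀ c, F c ∈ Literature.Geometry.Lorentzian.admissibleVacuumData X) ∧ (∃ A : Set (ℝ →
EuclideanSpace ℝ (Fin 2)), A.Finite ∧ (∀ γ ∈ A, (Continuous γ ∧ γ 0 = 0 ∧ DifferentiableAt ℝ γ 0 ∧
deriv γ 0 ≠ 0 ∧ ∀ t ∈ Set.Icc (0:ℝ) 1, γ t = 0 → t = 0)) ∧ ∀ᶠ c in nhds (0 : EuclideanSpace ℝ (Fin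
2)), ¬ ((∃ 𝒟 : Literature.Geometry.Lorentzian.VacuumCauchyDevelopment (F c), 𝒟.IsMaximal) ∧ ∀ 𝒟 :
Literature.Geometry.Lorentzian.VacuumCauchyDevelopment (F c), 𝒟.IsMaximal →
Summit.FinalStateConjecture.HasCompleteNullInfinity 𝒟.toCauchyDevelopment ∧ ∃ (O : Set 𝒟.carrier) (e
: Literature.Geometry.Lorentzian.FinalStateDecomposition 𝒟.toSpacetime O 2), (∀ i,
Literature.Geometry.Lorentzian.Kerr.IsSubextremal (e.mass i) (e.spin i)) ∧ O =
Summit.FinalStateConjecture.exteriorOf 𝒟.toCauchyDevelopment e.charted ∧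
Summit.FinalStateConjecture.HasExhaustiveCharts e) → c = 0 ∨ ∃ γ ∈ A, ∃ t ∈ Set.Icc (0:ℝ) 1, γ t =
c)`

## Assembly
Pure logic, kernel-checked in Sketch.lean/glue.lean (`theorem closes`, axioms
propext/Classical.choice/Quot.sound): fix X and
an exceptional d; AnalyticLocalUnfolding gives the probe F with dense good parameters;
TameCensorshipTraces and
TameSettlingTraces applied to F cannot return FAT (closure ∘ interior is monotone and the
clause-wise exceptional traces sit
inside the full one), so they return finite arc families A₁, A₂; since P = P_censorship ∧ P_settling
pointwise, the full
exceptional trace lies in the arcs of A₁ ∪ A₂, which is finite — "conjunction is free";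
ConeSelection with 𝓔 = {d ∈ 𝓓 |
¬P d} is `IsChristodoulouGeneric 𝓓 P 1` by `unfold`. Degenerate cases checked: A = ∅ is allowed
(trace ⊆ {0}); a constant
probe F ≡ d satisfies the dichotomies (FAT if d is clause-exceptional, THIN with A = ∅ otherwise)
and is excluded from the
unfolding crux by injectivity; 𝓔 = ∅ makes everything vacuous; m = 2 is the least dimension in which
cone selection works
(refuter flag (3) on the card).

Rationale: WHY THIS LINE. Christodoulou's topology-free curve quantifier (`IsChristodoulouGeneric … 1`,
Christodoulou1999 p. A24) is exactly the
conclusion of the CURVE SELECTION LEMMA of tame geometry (Dries1998 Ch. 6 §1; Milnor1968 §3;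
VandendriesMiller1996 4.17):
once the exceptional SET is tame with empty interior along a finite-dimensional analytic probe, an
escaping analytic arc
exists with no transversality, no defining functional and for any finite union of strata at once —
so the "conjunction
tax" of proving genericity clause by clause (card genericity-is-not-closed-under-and) is zero in the
tame register, which
the deciding theorem makes literal (union of two finite arc families). Tameness of SETS is asked,
never of MAPS: discrete
self-similarity makes outcome maps non-definable at every type-II threshold (mass-scaling fine
structure, Gundlach1997,
HodPiran1997) while threshold sets stay tame; the dynamical source of set-tameness is hyperbolicity
of critical solutions
in the analytic category (ReitererTrubowitz2019: Choptuik's spacetime is real-analytic) and, at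
resonant or
exchange-of-dominance thresholds where stable sets are only C^k, o-minimality of hyperbolic
transition maps
(KaiserRolinSpeissegger2009) — which is why the arcs are only asked to be differentiable at 0, not
analytic. Imported
areas: o-minimal/subanalytic geometry (curve selection, the cross-field precedent being
Niederman2006, where subanalytic
curve selection proves genericity of Nekhoroshev steepness) and analytic hyperbolic dynamics; the
probes are compactly
supported deformations of the datum (CorvinoSchoen2006, ChruscielDelay2003), so every witness is
LOCAL and the line is
orthogonal to the far-field escape of card swallow-the-datum-genericity-escape. Negatives index:
empty.

RANKED CRUXES. #0 TameExceptionalTraces (target) — X as in § Thesis — through every exceptional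
admissible datum passes a jointly smooth injective admissible 2-parameter family whose exceptional
trace near 0 lies in {0} ∪ finitely many arcs from 0 (continuous on [0,1], differentiable at 0 with
non-zero velocity, not returning to 0). (why it might fail: a chaotic (Cantor) or fat threshold
trace along every 2-probe through some datum, or a smooth stable naked singularity (Singh2024
scenario), makes it false; it also presupposes large-data settling off the thresholds.)
[Christodoulou1999, Dries1998, Niederman2006, Christodoulou1999instability]
#2 TameSettlingTraces (crux) — (card K1 for E_EXT/E_BR, settling clause) for every admissible datum
d and EVERY compactly supported, jointly smooth, admissible 2-probe F through d whose components are
real-analytic in the parameter with a uniform radius, the trace {c : some MGHD of F c fails to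
settle to finitely many sub-extremal Kerrs with exhaustive charts} is either FAT at 0 (0 ∈ closure
(interior trace)) or THIN at 0 (eventually contained in {0} ∪ finitely many arcs from 0 as in X).
[difficulty: open-problem] (why it might fail: Extremal thresholds (KehleUnger2025) have κ = 0: no
spectral gap, a parabolic critical point whose stable set may have flat oscillatory contact with
analytic probes; non-Kerr stationary ω-limits or N → ∞ cascades may accumulate at d; near good d it
needs large-|a| Kerr-basin openness.) [KehleUnger2025, arXiv:2104.08222, Hintz2026,
KaiserRolinSpeissegger2009, Literature.Barriers.FinalStateConjecture.AretakisInstability]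
#3 TameCensorshipTraces (crux) — (card K1 for E_NS, censorship clause) for every admissible d and
every compactly supported analytic admissible 2-probe F through d (as in rank 2), the trace {c : F c
has no MGHD or some MGHD of F c has incomplete 𝓘⁺} is FAT at 0 or THIN at 0. [difficulty:
open-problem] (why it might fail: Vacuum collapse shows no universal critical solution, competing
DSS modes (BaumgarteEtAl2023); a chaotic threshold (Cantor trace: SzybkaChmaj2008 in 4+1 Bianchi-IX
vacuum) or strata accumulating at d is neither FAT nor THIN; hyperbolicity of any vacuum critical
solution is numerical only.) [Gundlach1997, HodPiran1997, ReitererTrubowitz2019, BaumgarteEtAl2023,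
AbrahamsEvans1993, SzybkaChmaj2008, KaiserRolinSpeissegger2009, GundlachMartingarcia2007]
#4 AnalyticLocalUnfolding (crux) — (card K2/P1 side, the density half) through every admissible
datum d failing P passes a compactly supported, jointly smooth, INJECTIVE, admissible 2-probe F with
F 0 = d, components real-analytic in the parameter with a uniform radius, along which good
parameters are dense near 0: 0 ∉ closure (interior {c : ¬P(F c)}). [difficulty: open-problem] (why
it might fail: Needs good data DENSE near every exceptional datum along a LOCAL analytic probe:
false if a smooth naked singularity is stable under smooth perturbations (blue-shift needs rough
data: Singh2024; RSR2023 Rem. 1.5), if a datum is exceptional by its TAIL, or at KID-obstructed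
data.) [CorvinoSchoen2006, ChruscielDelay2003, Christodoulou1999instability, LiuLi2018, An2025,
Singh2024, RodnianskiShlapentokhRothman2023, MaoOhTao2023]
#9 ConeSelection (support) — (card P1+P2, curve selection in the form needed; provable now) for any
sets 𝓓, 𝓔 of initial data sets on X: if through every d ∈ 𝓔 passes a jointly smooth injective
2-parameter family in 𝓓 with F 0 = d whose 𝓔-trace near 0 lies in {0} ∪ finitely many arcs from 0
(continuous, differentiable at 0 with non-zero velocity, not returning to 0 on [0,1]), then
`HasCodimAtLeastIn 𝓓 𝓔 1`. Proof: pick a unit w ∈ ℝ² off the finitely many lines ℝγ'(0); γ(t) =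
tγ'(0) + o(t) keeps γ((0,δ]) off ℝw and continuity keeps γ([δ,1]) off a ball, so s ↦ F(s w) meets 𝓔
only at s = 0 for |s| small; reparametrise s = ε·(2/π)·arctan c (Real.contDiff_arctan) and compose
the ContMDiff family with the smooth map (c, x) ↦ (ρ(c)•w, x). [difficulty: provable-now]
[Dries1998, Milnor1968, VandendriesMiller1996]

TWO-LAYER PLAN. Foreseen glued splits (k ≤ 3, depth 1), filed only after a crux closes.
TameCensorshipTraces ⇐ FiniteTimeAnalyticDependence
(card K2: an analytic parameter entering smooth data analytically gives developments real-analytic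
in the parameter on
every compact slab, uniformly up to a lower-semicontinuous capture time; AlinhacMetivier1984-type
propagation, Kato
quasilinear theory) → HyperbolicAnalyticCriticalSolutions (card K1(b,c): every censorship-threshold
critical solution met
along a local probe is a hyperbolic fixed point / cycle of an analytic renormalisation map on a
Banach manifold of
self-similar-gauge data, with o-minimal (KRS-type) transition structure at resonances) →
CensorshipThresholdCensus (card
K1(d): the censorship-exceptional trace is the pull-back of finitely many such stable sets) →
TameCensorshipTraces.
TameSettlingTraces ⇐ the same triple for extremal thresholds (KehleUnger2025) and unstable
stationary ω-limits, plus
KerrBasinOpenAlongProbes (Cauchy stability + sub-extremal Kerr stability, Hintz2026 /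
KlainermanSzeftel2023 / DHRT).
AnalyticLocalUnfolding ⇐ LocalAnalyticDeformations (analytic implicit-function theorem for the
constraint map with
Corvino–Schoen weights: through every admissible datum and two compactly supported linearised
directions modulo KIDs
passes an analytic admissible 2-probe) → LocalInstabilityOfExceptionalData (some local direction
makes good parameters
dense: trapped-surface formation for censorship thresholds, Christodoulou1999instability / LiuLi2018
/ An2025; third-law
transversality for extremal thresholds) → AnalyticLocalUnfolding.

KILL CRITERIA. (i) A local analytic admissible 2-probe along which the black-hole/dispersion (or
extremality) threshold parameters form a
Cantor set or accumulate as infinitely many distinct arcs at the base point — chaotic criticality of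
Szybka–Chmaj type
(SzybkaChmaj2008) exhibited in vacuum or in any model embedding in the admissible class — refutes
TameCensorshipTraces
(resp. TameSettlingTraces): close `refuted:TameCensorshipTraces`, record the witness for
threshold-lamination's negative
side. (ii) A smooth admissible naked-singularity datum stable under smooth compactly supported
perturbations (the Singh2024
scenario made nonlinear) refutes AnalyticLocalUnfolding and, along local probes, the typed summit
itself: close refuted and
hand to the statement auditors. (iii) If the far-field-escape line (card
swallow-the-datum-genericity-escape) proves the
typed Statement first, this route is moot as a proof of the CURRENT typing but its cruxes are
exactly the content a
re-typed (weighted-continuous-family) genericity clause would ask — pivot by restating the probes,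
not by closing.
(iv) A counterexample to ConeSelection can only be a typing slip (restate, same content).

NOT DECOMPOSED YET. Deliberately left for layer 2: finite-time analytic dependence (card K2) and the
locally bounded capture time (refuter flag
(2) on the card); hyperbolicity/analyticity of critical solutions species by species
(naked-singularity profiles,
extremal thresholds, unstable stationary states); the census "exceptional = captured by a critical
solution"; KIDs and
the analytic implicit-function theorem for compactly supported deformations; the non-tame locus of
card K3 (partly
ABSORBED: arcs need only be differentiable at 0, so resonant C^k junction strata with x^{λ₁/λ₂},
xⁿlog x contacts are
allowed; chaos is conceded as kill criterion (i)); the corrected "wild maps" remark (card P3) is not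
an item: the mass map
M(p) = C|p−p*|^γ e^{ψ(ln|p−p*|)} IS monotone when the echo amplitude is small (γ + ψ′ > 0), what is
non-definable is its
logarithmic derivative uM′/M = γ + ψ′(ln u), whose super-level set {uM′ > γM} has infinitely many
components at p*.

CHEAPEST FALSIFIER. Numerics on a 2-parameter ANALYTIC family in the cheapest model with a
censorship threshold (spherically symmetric
Einstein–massless-scalar, Choptuik1993; then twist-free axisymmetric vacuum Brill/Teukolsky waves,
BaumgarteEtAl2023):
locate the threshold curve q ↦ p*(q) by bisection at ~40 values of q to relative precision 10⁻¹²,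
and test (a) the
uncertainty exponent α of the basin boundary along generic lines (α = 1 ⇔ no Cantor structure; α < 1
kills
TameCensorshipTraces) and (b) geometric decay of the Chebyshev coefficients of q ↦ p*(q) (analytic
arc) versus algebraic
decay (finitely smooth junction — still allowed) versus no decay (wild). Not run here (compute-free
hub, plancard seat);
recorded for the refuter. Lookup falsifier: any printed vacuum or Einstein–matter example of chaotic
critical collapse FROM
ASYMPTOTICALLY FLAT REGULAR DATA (SzybkaChmaj2008 is the candidate to read first).

NUMBERS. Choptuik scalar-field threshold: γ ≈ 0.374, echoing period Δ ≈ 3.4453 (Gundlach1997),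
fine-structure period Δ/(2γ) ≈ 4.61
in ln|p − p*| (HodPiran1997); vacuum Brill waves: Δ ≈ 0.6, γ ≈ 0.36 (AbrahamsEvans1993), no
universal critical solution
found in BaumgarteEtAl2023; codimension of the Schwarzschild attractor inside the Kerr basin = 3
(arXiv:2104.08222);
extremal Reissner–Nordström/Kerr formation thresholds exist (KehleUnger2025) with conjectural
codimension-1 stability;
m = 2 probe dimension (least possible); items at open: 6 (3 cruxes, 1 target, 1 support, 1
assembly); every Lean term
elaborated (Sketch.lean rc 0, closes sorry-free).

DEFINITION REQUESTS. None needed to elaborate: all items are stated over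
`Literature.Geometry.Lorentzian.{admissibleVacuumData, InitialDataSet.IsSmoothDataFamily,
InitialDataSet.HasCodimAtLeastIn, VacuumCauchyDevelopment, FinalStateDecomposition,
Kerr.IsSubextremal}`, `Summit.FinalStateConjecture.{HasCompleteNullInfinity, exteriorOf,
HasExhaustiveCharts}` and Mathlib (`AnalyticOnNhd`, `closure`, `interior`, `deriv`). Convenience
only (not filed): an abbreviation `InitialDataSet.IsAnalyticLocalProbe d F` (compact support +
jointly smooth + admissible + componentwise analytic with uniform radius) in
Literature/Geometry/Lorentzian/Genericity.lean would shorten the three cruxes; any such change must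
restate ranks 2, 3, 4 together (the probe class occurs with opposite polarity in 2/3 and 4).

Novelty: Searches (2026-08-15, this seat): `lit galaxy search "curve selection lemma" --star all` (30 rows:
van den Dries 1998 panama:216397632241664, Milnor 1968 panama:495579096416350,
Kurdyka–Mostowski–Parusiński gradient conjecture, Lipschitz geometry of singularities — no
relativity or PDE-genericity use); `lit search "Hamiltonian stability subanalytic geometry
Nekhoroshev steepness curve selection"` and `lit galaxy search "hyperbolic singularities are
o-minimal" --star pdf` (searchd/galaxyd unavailable, rc 75 / queue-saturated at 15:50Z — recorded,
not retried into a claim); Crossref-verified via `lit cite`: 10.5802/aif.2200 (Niederman2006),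
10.1515/CRELLE.2009.081 (KaiserRolinSpeissegger2009), 10.1215/S0012-7094-96-08416-1
(VandendriesMiller1996), 10.4310/jdg/1146169910 (CorvinoSchoen2006), 10.24033/msmf.407
(ChruscielDelay2003), 10.1103/PhysRevLett.131.181401 (BaumgarteEtAl2023 = arXiv:2305.17171),
10.1007/s00220-019-03413-8 (ReitererTrubowitz2019), 10.1103/PhysRevD.55.R440 (HodPiran1997); plus
the card's own audited searches of today (zbMATH "curve selection lemma o-minimal" 0, "o-minimal
general relativity" 0, vsearch on held books) and the refuter's novelty audit (unit 5) naming
Niederman2006 as nearest cross-field precedent; pool census of the 91 FinalStateConjecture cards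
(tame-or-fractal retired, threshold-lamination declined, genericity-is-not-closed-under-and,
prevalence-universal-pulse-probe, saddles-organise-the-exceptional-set,
swallow-the-datum-genericity-escape re  [refs: 10.5802/aif.2200, 10.1515/CRELLE.2009.081, 10.1215/S0012-7094-96-08416-1, 10.4310/jdg/1146169910, 10.24033/msmf.407, 10.1103/PhysRevLett.131.181401, 10.1007/s00220-019-03413-8, 10.1103/PhysRevD.55.R440, 2305.17171, Niederman2006, KaiserRolinSpeissegger2009, VandendriesMiller1996, CorvinoSchoen2006, ChruscielDelay2003, BaumgarteEtAl2023, ReitererTrubowitz2019, HodPiran1997, Dries1998]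

Barriers (technique_class: o-minimal-curve-selection, analytic-stable-manifold): - technique_class: o-minimal-curve-selection, analytic-stable-manifold
- Literature.Barriers.FinalStateConjecture.nakedSingularityInstability: on the permitted side —
genericity is kept in Christodoulou's exact typed form and the route supplies curve witnesses, never
an all-data claim; the barrier's own 2-planes ϑ + span{f₁,f₂} are local probes with THIN trace {0};
its scope caveat (b) (Singh2024: no blue-shift instability for smooth perturbations) is precisely
the why-might-fail of AnalyticLocalUnfolding, flagged not evaded.
- Literature.Barriers.FinalStateConjecture.AretakisInstability: touches TameSettlingTraces at
extremal thresholds — κ = 0 removes the spectral gap, so the threshold's critical point is not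
hyperbolic and tameness of its stable set is the bet (the arc formulation tolerates finite
smoothness but not flat oscillation); not evaded. AretakisInstabilityNarrow: same.
- Literature.Barriers.FinalStateConjecture.KehrbergerLogarithmicAsymptotics: not met (no conformal
compactification, complete 𝓘⁺ only through the summit's sojourn form); logarithmic terms are the
kind of non-analytic-but-tame behaviour the arc formulation was chosen to tolerate.
KehrbergerLogarithmicAsymptoticsCorrected: same.
- Literature.Barriers.FinalStateConjecture.SlowlyRotatingKerrFrontier: not met at layer 1 (no
stability estimate is claimed); it is met head-on in layer 2 under TameSettlingTraces (openness of
the good set along probes through good data needs sub-extremal Kerr stability at al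

sub-problem: FinalStateConjecture · status: open · opened planner-plancard-FinalStateConjecture-FinalSt-ddc8f326-0 2026-08-15T15:11:49Z · rev 0 · ledger route-FinalStateConjecture-TameStrataCurveSelection
GENERATED by the gate from the ledger (D-0016/17). Provers cite these decls: `theorem foo : Summit.FinalStateConjecture.FinalStateConjecture.Theses.TameStrataCurveSelection.<Decl> := …` in Summits/FinalStateConjecture/FinalStateConjecture/Theorems/<Name>.lean.
-/

namespace Summit.FinalStateConjecture.FinalStateConjecture.Theses.TameStrataCurveSelection

open scoped BigOperators Topology Manifold Classical MeasureTheory ProbabilityTheory Matrix InnerProductSpace ComplexConjugate ContinuousMap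
open Filter Set Function TopologicalSpace MeasureTheory

attribute [summit_statement] _root_.FinalStateConjecture

/-- item stmt-FinalStateConjecture-10105 · target · rank 0 · open · by planner
why it might fail: a chaotic (Cantor) or fat threshold trace along every 2-probe through some datum, or a smooth stable naked singularity (Singh2024 scenario), makes it false; it also presupposes large-data settling off the thresholds.
sources: Christodoulou1999, Dries1998, Niederman2006, Christodoulou1999instability
[target] X as in § Thesis — through every exceptional admissible datum passes a jointly smooth
injective admissible 2-parameter family whose exceptional trace near 0 lies in {0} ∪ finitely many
arcs from 0 (continuous on [0,1], differentiable at 0 with non-zero velocity, not returning to 0). -/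
@[route_item "route-FinalStateConjecture-TameStrataCurveSelection"]
def TameExceptionalTraces : Prop :=
  ∀ (X : Type) [TopologicalSpace X] [ChartedSpace (EuclideanSpace ℝ (Fin 3)) X] [IsManifold (𝓡 3) ((⊤ : ℕ∞) : WithTop ℕ∞) X] [T2Space X] [SecondCountableTopology X] [ConnectedSpace X], ∀ d ∈ Literature.Geometry.Lorentzian.admissibleVacuumData X, ¬ ((∃ 𝒟 : Literature.Geometry.Lorentzian.VacuumCauchyDevelopment d, 𝒟.IsMaximal) ∧ ∀ 𝒟 : Literature.Geometry.Lorentzian.VacuumCauchyDevelopment d, 𝒟.IsMaximal → Summit.FinalStateConjecture.HasCompleteNullInfinity 𝒟.toCauchyDevelopment ∧ ∃ (O : Set 𝒟.carrier) (e : Literature.Geometry.Lorentzian.FinalStateDecomposition 𝒟.toSpacetime O 2), (∀ i, Literature.Geometry.Lorentzian.Kerr.IsSubextremal (e.mass i) (e.spin i)) ∧ O = Summit.FinalStateConjecture.exteriorOf 𝒟.toCauchyDevelopment e.charted ∧ Summit.FinalStateConjecture.HasExhaustiveCharts e) → ∃ F : EuclideanSpace ℝ (Fin 2) → Literature.Geometry.Lorentzian.InitialDataSet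 (𝓡 3) X, Literature.Geometry.Lorentzian.InitialDataSet.IsSmoothDataFamily 2 F ∧ F 0 = d ∧ Function.Injective F ∧ (∀ c, F c ∈ Literature.Geometry.Lorentzian.admissibleVacuumData X) ∧ (∃ A : Set (ℝ → EuclideanSpace ℝ (Fin 2)), A.Finite ∧ (∀ γ ∈ A, (Continuous γ ∧ γ 0 = 0 ∧ DifferentiableAt ℝ γ 0 ∧ deriv γ 0 ≠ 0 ∧ ∀ t ∈ Set.Icc (0:ℝ) 1, γ t = 0 → t = 0)) ∧ ∀ᶠ c in nhds (0 : EuclideanSpace ℝ (Fin 2)), ¬ ((∃ 𝒟 : Literature.Geometry.Lorentzian.VacuumCauchyDevelopment (F c), 𝒟.IsMaximal) ∧ ∀ 𝒟 : Literature.Geometry.Lorentzian.VacuumCauchyDevelopment (F c), 𝒟.IsMaximal → Summit.FinalStateConjecture.HasCompleteNullInfinity 𝒟.toCauchyDevelopment ∧ ∃ (O : Set 𝒟.carrier) (e : Literature.Geometry.Lorentzian.FinalStateDecomposition 𝒟.toSpacetime O 2), (∀ i, Literature.Geometry.Lorentzian.Kerr.IsSubextremal (e.mass i) (e.spin i)) ∧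 O = Summit.FinalStateConjecture.exteriorOf 𝒟.toCauchyDevelopment e.charted ∧ Summit.FinalStateConjecture.HasExhaustiveCharts e) → c = 0 ∨ ∃ γ ∈ A, ∃ t ∈ Set.Icc (0:ℝ) 1, γ t = c)

/-- item stmt-FinalStateConjecture-10107 · crux · rank 2 · open · by planner
why it might fail: Extremal thresholds (KehleUnger2025) have κ = 0: no spectral gap, a parabolic critical point whose stable set may have flat oscillatory contact with analytic probes; non-Kerr stationary ω-limits or N → ∞ cascades may accumulate at d; near good d it needs large-|a| Kerr-basin openness.
sources: KehleUnger2025, arXiv:2104.08222, Hintz2026, KaiserRolinSpeissegger2009, Literature.Barriers.FinalStateConjecture.AretakisInstability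
[crux] (card K1 for E_EXT/E_BR, settling clause) for every admissible datum d and EVERY compactly
supported, jointly smooth, admissible 2-probe F through d whose components are real-analytic in the
parameter with a uniform radius, the trace {c : some MGHD of F c fails to settle to finitely many
sub-extremal Kerrs with exhaustive charts} is either FAT at 0 (0 ∈ closure (interior trace)) or THIN
at 0 (eventually contained in {0} ∪ finitely many arcs from 0 as in X). [difficulty: open-problem] -/
@[route_item "route-FinalStateConjecture-TameStrataCurveSelection", crux]
def TameSettlingTraces : Prop :=
  ∀ (X : Type) [TopologicalSpace X] [ChartedSpace (EuclideanSpace ℝ (Fin 3)) X] [IsManifold (𝓡 3) ((⊤ : ℕ∞) : WithTop ℕ∞) X] [T2Space X] [SecondCountableTopology X] [ConnectedSpace X], ∀ d ∈ Literature.Geometry.Lorentzian.admissibleVacuumData X, ∀ F : EuclideanSpace ℝ (Fin 2) → Literature.Geometry.Lorentzian.InitialDataSet (𝓡 3) X, Literature.Geometry.Lorentzian.InitialDataSet.IsSmoothDataFamily 2 F → F 0 = d → (∀ c, F c ∈ Literature.Geometry.Lorentzian.admissibleVacuumData X) → (∃ K : Set X, IsCompact K ∧ ∀ c, ∀ x ∉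 K, (F c).h.inner x = d.h.inner x ∧ (F c).k x = d.k x) → (∃ r : ℝ, 0 < r ∧ ∀ (x : X) (v w : TangentSpace (𝓡 3) x), AnalyticOnNhd ℝ (fun c ↦ (F c).h.inner x v w) (Metric.ball 0 r) ∧ AnalyticOnNhd ℝ (fun c ↦ (F c).k x v w) (Metric.ball 0 r)) → ((0 : EuclideanSpace ℝ (Fin 2)) ∈ closure (interior {c : EuclideanSpace ℝ (Fin 2) | ¬ (∀ 𝒟 : Literature.Geometry.Lorentzian.VacuumCauchyDevelopment (F c), 𝒟.IsMaximal → ∃ (O : Set 𝒟.carrier) (e : Literature.Geometry.Lorentzian.FinalStateDecomposition 𝒟.toSpacetime O 2), (∀ i, Literature.Geometry.Lorentzian.Kerr.IsSubextremal (e.mass i) (e.spin i)) ∧ O = Summit.FinalStateConjecture.exteriorOf 𝒟.toCauchyDevelopment e.charted ∧ Summit.FinalStateConjecture.HasExhaustiveCharts e)})) ∨ (∃ A : Set (ℝ → EuclideanSpace ℝ (Fin 2)), A.Finite ∧ (∀ γ ∈ A, (Continuous γ ∧ γ 0 = 0 ∧ DifferentiableAt ℝ γ 0 ∧ deriv γ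 0 ≠ 0 ∧ ∀ t ∈ Set.Icc (0:ℝ) 1, γ t = 0 → t = 0)) ∧ ∀ᶠ c in nhds (0 : EuclideanSpace ℝ (Fin 2)), ¬ (∀ 𝒟 : Literature.Geometry.Lorentzian.VacuumCauchyDevelopment (F c), 𝒟.IsMaximal → ∃ (O : Set 𝒟.carrier) (e : Literature.Geometry.Lorentzian.FinalStateDecomposition 𝒟.toSpacetime O 2), (∀ i, Literature.Geometry.Lorentzian.Kerr.IsSubextremal (e.mass i) (e.spin i)) ∧ O = Summit.FinalStateConjecture.exteriorOf 𝒟.toCauchyDevelopment e.charted ∧ Summit.FinalStateConjecture.HasExhaustiveCharts e) → c = 0 ∨ ∃ γ ∈ A, ∃ t ∈ Set.Icc (0:ℝ) 1, γ t = c)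

/-- item stmt-FinalStateConjecture-10108 · crux · rank 3 · open · by planner
why it might fail: Vacuum collapse shows no universal critical solution, competing DSS modes (BaumgarteEtAl2023); a chaotic threshold (Cantor trace: SzybkaChmaj2008 in 4+1 Bianchi-IX vacuum) or strata accumulating at d is neither FAT nor THIN; hyperbolicity of any vacuum critical solution is numerical only.
sources: Gundlach1997, HodPiran1997, ReitererTrubowitz2019, BaumgarteEtAl2023, AbrahamsEvans1993, SzybkaChmaj2008
[crux] (card K1 for E_NS, censorship clause) for every admissible d and every compactly supported
analytic admissible 2-probe F through d (as in rank 2), the trace {c : F c has no MGHD or some MGHD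
of F c has incomplete 𝓘⁺} is FAT at 0 or THIN at 0. [difficulty: open-problem] -/
@[route_item "route-FinalStateConjecture-TameStrataCurveSelection", crux]
def TameCensorshipTraces : Prop :=
  ∀ (X : Type) [TopologicalSpace X] [ChartedSpace (EuclideanSpace ℝ (Fin 3)) X] [IsManifold (𝓡 3) ((⊤ : ℕ∞) : WithTop ℕ∞) X] [T2Space X] [SecondCountableTopology X] [ConnectedSpace X], ∀ d ∈ Literature.Geometry.Lorentzian.admissibleVacuumData X, ∀ F : EuclideanSpace ℝ (Fin 2) → Literature.Geometry.Lorentzian.InitialDataSet (𝓡 3) X, Literature.Geometry.Lorentzian.InitialDataSet.IsSmoothDataFamily 2 F → F 0 = d → (∀ c, F c ∈ Literature.Geometry.Lorentzian.admissibleVacuumData X) → (∃ K : Set X, IsCompact K ∧ ∀ c, ∀ x ∉ K, (F c).h.inner x = d.h.inner x ∧ (F c).k x = d.k x) → (∃ r : ℝ, 0 < r ∧ ∀ (x : X) (v w : TangentSpace (𝓡 3) x), AnalyticOnNhd ℝ (fun c ↦ (F c).h.inner x v w) (Metric.ball 0 r) ∧ AnalyticOnNhd ℝ (fun c ↦ (F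 c).k x v w) (Metric.ball 0 r)) → ((0 : EuclideanSpace ℝ (Fin 2)) ∈ closure (interior {c : EuclideanSpace ℝ (Fin 2) | ¬ ((∃ 𝒟 : Literature.Geometry.Lorentzian.VacuumCauchyDevelopment (F c), 𝒟.IsMaximal) ∧ ∀ 𝒟 : Literature.Geometry.Lorentzian.VacuumCauchyDevelopment (F c), 𝒟.IsMaximal → Summit.FinalStateConjecture.HasCompleteNullInfinity 𝒟.toCauchyDevelopment)})) ∨ (∃ A : Set (ℝ → EuclideanSpace ℝ (Fin 2)), A.Finite ∧ (∀ γ ∈ A, (Continuous γ ∧ γ 0 = 0 ∧ DifferentiableAt ℝ γ 0 ∧ deriv γ 0 ≠ 0 ∧ ∀ t ∈ Set.Icc (0:ℝ) 1, γ t = 0 → t = 0)) ∧ ∀ᶠ c in nhds (0 : EuclideanSpace ℝ (Fin 2)), ¬ ((∃ 𝒟 : Literature.Geometry.Lorentzian.VacuumCauchyDevelopment (F c), 𝒟.IsMaximal) ∧ ∀ 𝒟 : Literature.Geometry.Lorentzian.VacuumCauchyDevelopment (F c), 𝒟.IsMaximal → Summit.FinalStateConjecture.HasCompleteNullInfinity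 𝒟.toCauchyDevelopment) → c = 0 ∨ ∃ γ ∈ A, ∃ t ∈ Set.Icc (0:ℝ) 1, γ t = c)

/-- item stmt-FinalStateConjecture-10109 · crux · rank 4 · open · by planner
why it might fail: Needs good data DENSE near every exceptional datum along a LOCAL analytic probe: false if a smooth naked singularity is stable under smooth perturbations (blue-shift needs rough data: Singh2024; RSR2023 Rem. 1.5), if a datum is exceptional by its TAIL, or at KID-obstructed data.
sources: CorvinoSchoen2006, ChruscielDelay2003, Christodoulou1999instability, LiuLi2018, An2025, Singh2024
[crux] (card K2/P1 side, the density half) through every admissible datum d failing P passes a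
compactly supported, jointly smooth, INJECTIVE, admissible 2-probe F with F 0 = d, components
real-analytic in the parameter with a uniform radius, along which good parameters are dense near 0:
0 ∉ closure (interior {c : ¬P(F c)}). [difficulty: open-problem] -/
@[route_item "route-FinalStateConjecture-TameStrataCurveSelection", crux]
def AnalyticLocalUnfolding : Prop :=
  ∀ (X : Type) [TopologicalSpace X] [ChartedSpace (EuclideanSpace ℝ (Fin 3)) X] [IsManifold (𝓡 3) ((⊤ : ℕ∞) : WithTop ℕ∞) X] [T2Space X] [SecondCountableTopology X] [ConnectedSpace X], ∀ d ∈ Literature.Geometry.Lorentzian.admissibleVacuumData X, ¬ ((∃ 𝒟 : Literature.Geometry.Lorentzian.VacuumCauchyDevelopment d, 𝒟.IsMaximal) ∧ ∀ 𝒟 : Literature.Geometry.Lorentzian.VacuumCauchyDevelopment d, 𝒟.IsMaximal → Summit.FinalStateConjecture.HasCompleteNullInfinity 𝒟.toCauchyDevelopment ∧ ∃ (O : Set 𝒟.carrier) (e : Literature.Geometry.Lorentzian.FinalStateDecomposition 𝒟.toSpacetime O 2), (∀ i, Literature.Geometry.Lorentzian.Kerr.IsSubextremal (e.mass i) (e.spin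 i)) ∧ O = Summit.FinalStateConjecture.exteriorOf 𝒟.toCauchyDevelopment e.charted ∧ Summit.FinalStateConjecture.HasExhaustiveCharts e) → ∃ F : EuclideanSpace ℝ (Fin 2) → Literature.Geometry.Lorentzian.InitialDataSet (𝓡 3) X, Literature.Geometry.Lorentzian.InitialDataSet.IsSmoothDataFamily 2 F ∧ F 0 = d ∧ Function.Injective F ∧ (∀ c, F c ∈ Literature.Geometry.Lorentzian.admissibleVacuumData X) ∧ (∃ K : Set X, IsCompact K ∧ ∀ c, ∀ x ∉ K, (F c).h.inner x = d.h.inner x ∧ (F c).k x = d.k x) ∧ (∃ r : ℝ, 0 < r ∧ ∀ (x : X) (v w : TangentSpace (𝓡 3) x), AnalyticOnNhd ℝ (fun c ↦ (F c).h.inner x v w) (Metric.ball 0 r) ∧ AnalyticOnNhd ℝ (fun c ↦ (F c).k x v w) (Metric.ball 0 r)) ∧ (0 : EuclideanSpace ℝ (Fin 2)) ∉ closure (interior {c : EuclideanSpace ℝ (Fin 2) | ¬ ((∃ 𝒟 : Literature.Geometry.Lorentzian.VacuumCauchyDevelopment (F c), 𝒟.IsMaximal) ∧ ∀ 𝒟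 : Literature.Geometry.Lorentzian.VacuumCauchyDevelopment (F c), 𝒟.IsMaximal → Summit.FinalStateConjecture.HasCompleteNullInfinity 𝒟.toCauchyDevelopment ∧ ∃ (O : Set 𝒟.carrier) (e : Literature.Geometry.Lorentzian.FinalStateDecomposition 𝒟.toSpacetime O 2), (∀ i, Literature.Geometry.Lorentzian.Kerr.IsSubextremal (e.mass i) (e.spin i)) ∧ O = Summit.FinalStateConjecture.exteriorOf 𝒟.toCauchyDevelopment e.charted ∧ Summit.FinalStateConjecture.HasExhaustiveCharts e)})

/-- item stmt-FinalStateConjecture-10112 · support · rank 9 · open · by planner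
sources: Dries1998, Milnor1968, VandendriesMiller1996
[support] (card P1+P2, curve selection in the form needed; provable now) for any sets 𝓓, 𝓔 of
initial data sets on X: if through every d ∈ 𝓔 passes a jointly smooth injective 2-parameter family
in 𝓓 with F 0 = d whose 𝓔-trace near 0 lies in {0} ∪ finitely many arcs from 0 (continuous,
differentiable at 0 with non-zero velocity, not returning to 0 on [0,1]), then `HasCodimAtLeastIn 𝓓
𝓔 1`. Proof: pick a unit w ∈ ℝ² off the finitely many lines ℝγ'(0); γ(t) = tγ'(0) + o(t) keeps
γ((0,δ]) off ℝw and continuity keeps γ([δ,1]) off a ball, so s ↦ F(s w) meets 𝓔 only at s = 0 for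
|s| small; reparametrise s = ε·(2/π)·arctan c (Real.contDiff_arctan) and compose the ContMDiff
family with the smooth map (c, x) ↦ (ρ(c)•w, x). [difficulty: provable-now] -/
@[route_item "route-FinalStateConjecture-TameStrataCurveSelection", crux]
def ConeSelection : Prop :=
  ∀ (X : Type) [TopologicalSpace X] [ChartedSpace (EuclideanSpace ℝ (Fin 3)) X] [IsManifold (𝓡 3) ((⊤ : ℕ∞) : WithTop ℕ∞) X] [T2Space X] [SecondCountableTopology X] [ConnectedSpace X], ∀ 𝓓 𝓔 : Set (Literature.Geometry.Lorentzian.InitialDataSet (𝓡 3) X), (∀ d ∈ 𝓔, ∃ F : EuclideanSpace ℝ (Fin 2) → Literature.Geometry.Lorentzian.InitialDataSet (𝓡 3) X, Literature.Geometry.Lorentzian.InitialDataSet.IsSmoothDataFamily 2 F ∧ F 0 = d ∧ Function.Injective F ∧ (∀ c, F c ∈ 𝓓) ∧ (∃ A : Set (ℝ → EuclideanSpace ℝ (Fin 2)), A.Finite ∧ (∀ γ ∈ A, (Continuous γ ∧ γ 0 = 0 ∧ DifferentiableAt ℝ γ 0 ∧ deriv γ 0 ≠ 0 ∧ ∀ t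 ∈ Set.Icc (0:ℝ) 1, γ t = 0 → t = 0)) ∧ ∀ᶠ c in nhds (0 : EuclideanSpace ℝ (Fin 2)), F c ∈ 𝓔 → c = 0 ∨ ∃ γ ∈ A, ∃ t ∈ Set.Icc (0:ℝ) 1, γ t = c)) → Literature.Geometry.Lorentzian.InitialDataSet.HasCodimAtLeastIn 𝓓 𝓔 1

/-- item stmt-FinalStateConjecture-10113 · assembly · rank 1 · open · by planner
sources: Christodoulou1999, Dries1998
[assembly] TameSettlingTraces → TameCensorshipTraces → AnalyticLocalUnfolding → ConeSelection →
FinalStateConjecture (the deciding theorem `closes` has exactly this shape). -/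
@[route_item "route-FinalStateConjecture-TameStrataCurveSelection"]
def Assembly : Prop :=
  TameSettlingTraces → TameCensorshipTraces → AnalyticLocalUnfolding → ConeSelection → FinalStateConjecture

/-! D-0027 §2.1 — DECIDING THEOREM (planner-authored via `route open/edit --closes-file`; by planner-plancard-FinalStateConjecture-FinalSt-ddc8f326-0 2026-08-15T15:11:49Z):
its hypotheses are this route's items and its conclusion the sub-problem Statement (glue_lint), and it elaborates with this file. -/

/-- D-0027 §2.1 DECIDING THEOREM of route TameStrataCurveSelection: the three cruxes
(`TameSettlingTraces`, `TameCensorshipTraces`, `AnalyticLocalUnfolding`) and the provable-now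
support lemma `ConeSelection` imply the sub-problem statement `FinalStateConjecture` by pure
logic: along the unfolding probe the two exceptional traces cannot be fat (good parameters are
dense), so each lies in finitely many arcs; "conjunction is free" = the union of two finite arc
families is a finite arc family; cone selection then returns Christodoulou's curve. -/
@[closes "route-FinalStateConjecture-TameStrataCurveSelection"] theorem closes (hS : TameSettlingTraces) (hC : TameCensorshipTraces)
    (hU : AnalyticLocalUnfolding) (hL : ConeSelection) : FinalStateConjecture := by
  intro X _ _ _ _ _ _
  unfold Literature.Geometry.Lorentzian.InitialDataSet.IsChristodoulouGeneric
  refine hL X _ _ ?_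
  rintro d ⟨hdD, hdP⟩
  obtain ⟨F, hF, h0, hinj, hD, hK, hr, hdense⟩ := hU X d hdD hdP
  rcases hC X d hdD F hF h0 hD hK hr with hfat | ⟨A₁, hA₁, harc₁, hev₁⟩
  · refine (hdense (closure_mono (interior_mono ?_) hfat)).elim
    intro c hc hP
    exact hc ⟨hP.1, fun 𝒟 h𝒟 => (hP.2 𝒟 h𝒟).1⟩
  rcases hS X d hdD F hF h0 hD hK hr with hfat | ⟨A₂, hA₂, harc₂, hev₂⟩
  · refine (hdense (closure_mono (interior_mono ?_) hfat)).elim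
    intro c hc hP
    exact hc fun 𝒟 h𝒟 => (hP.2 𝒟 h𝒟).2
  refine ⟨F, hF, h0, hinj, hD, A₁ ∪ A₂, hA₁.union hA₂, ?_, ?_⟩
  · rintro γ (hγ | hγ)
    exacts [harc₁ γ hγ, harc₂ γ hγ]
  · filter_upwards [hev₁, hev₂] with c hc₁ hc₂ hE
    by_contra hgoal
    have key : ∀ {p q : Prop}, (¬ p → q) → (q → False) → p :=
      fun h1 h2 => Classical.byContradiction fun hp => h2 (h1 hp)
    have hp1 := key hc₁ fun h => hgoal (h.imp_right fun ⟨γ, hγ, t, ht, e⟩ => ⟨γ, Or.inl hγ, t, ht, e⟩)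
    have hp2 := key hc₂ fun h => hgoal (h.imp_right fun ⟨γ, hγ, t, ht, e⟩ => ⟨γ, Or.inr hγ, t, ht, e⟩)
    exact hE.2 ⟨hp1.1, fun 𝒟 h𝒟 => ⟨hp1.2 𝒟 h𝒟, hp2 𝒟 h𝒟⟩⟩

end Summit.FinalStateConjecture.FinalStateConjecture.Theses.TameStrataCurveSelection
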